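import Mathlib
import HarnessLib
import Literature.Analysis.FluidPDE.ClassicalSolution
import Literature.Analysis.FluidPDE.VectorCalculus
import Literature.Analysis.FluidPDE.SwirlTransportProofs
import Summits.NavierStokesRegularity.NavierStokesRegularity.Theorems.UnthreadedRigidityDoorUnthreadedRigidityThreadingJetsSplit
import Summits.NavierStokesRegularity.NavierStokesRegularity.Theorems.UnthreadedRigidityDoorUnthreadedRigidityThreadingJetsVirialLemma
import Summits.NavierStokesRegularity.NavierStokesRegularity.Theorems.UnthreadedRigidityDoorUnthreadedRigidityThreadingJetsWindowGeneric
import Summits.NavierStokesRegularity.NavierStokesRegularity.Theorems.UnthreadedRigidityDoorUnthreadedRigidityThreadingJetsSlice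
import Summits.NavierStokesRegularity.NavierStokesRegularity.Theorems.UnthreadedRigidityDoorUnthreadedRigidityVirialHornOrderTwoLaw
import Summits.NavierStokesRegularity.NavierStokesRegularity.Theorems.UnthreadedRigidityDoorUnthreadedRigidityVirialHornNondegeneracy
import Summits.NavierStokesRegularity.NavierStokesRegularity.Theorems.UnthreadedRigidityDoorUnthreadedRigidityVirialHornZonal
import Summits.NavierStokesRegularity.NavierStokesRegularity.Theorems.UnthreadedRigidityDoorUnthreadedRigidityVirialHornAngularLemma
import Summits.NavierStokesRegularity.NavierStokesRegularity.Theorems.UnthreadedRigidityDoorUnthreadedRigidityVirialHornWindowAxisUniform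
import Summits.NavierStokesRegularity.NavierStokesRegularity.Theorems.UnthreadedRigidityDoorUnthreadedRigidityVirialHornShellDecay
import Summits.NavierStokesRegularity.NavierStokesRegularity.Theorems.UnthreadedRigidityDoorUnthreadedRigidityVirialHornDegreeTwo

/-!
# Route `UnthreadedRigidityDoor`, item `UnthreadedRigidity` (W2, stmt-NavierStokesRegularity-27585) — THREADING JETS:
# ★★ the SEPARABLE RUNGS IN EVERY DEGREE, UNCONDITIONALLY — the separable WINDOW rung (every degree, time-dependent profile and harmonic),
# `VirialHorn.IsotypicWindowRigidityL l 1`, g10-2's `ProfileHorn.SeparableWindowRigidity`, and the SLICE rung for analytic profiles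

Prover file (engine-1 g72; `--supports stmt-NavierStokesRegularity-27585 --as helper`).  Pure compositions of tree theorems of LINE g11-1 «VIRIAL HORN»
(planner ns-idea-6; hands ns-crc-p1 g7/g8, ns-crc-p2 g8, engine-1 g71) — no Theses module in the import closure:

* the generic order-two slice law (A) `VirialHorn.orderTwoLawSlice_holds` + (B′) `virialLemmaSlice_holds`, glued by `orderTwoSliceLawGeneric_of_split`;
* bridge V-W `virialWindowSilence_of_genericSliceLaw` with the shell-`L⁴` fact `VirialHorn.memLp_four_sepShellL` — i.e. `VirialWindowSilence`
  (re-derived here because the tree's `virialWindowSilence_holds` lives in a module that imports route files);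
* S-V `VirialHorn.virialNondegeneracy_holds`, S-C `VirialHorn.angularLemma_holds` (ALL degrees, engine-1 g71), S-Z `VirialHorn.zonalShellAxisym_holds`,
  S-U `VirialHorn.windowAxisUniform_holds`;
* at the slice level: the window-genericity tools `vortAmpL_generic_or_zero`, `virialMoment_eq_zero_of_vortAmpL_eq_zero` (file `…WindowGeneric`)
  and the jet dictionary `iteratedDerivWithin_two_threadingFlux_Ici_eq_fluxJetTwo`, `laplacian_pressure_eq_Ico` (file `…Slice`).

RESULTS.
§1 ★★ `separableWindow_sliceAxisym` / `separableWindowRigidityL`: in an unthreaded window (hypotheses of 27585 VERBATIM) every slice of which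
   is a virial-admissible SEPARABLE shell `curl curl (H_t(|y|) Y_t(y) y)` of degree `l ≥ 1` about `x₀` (profile AND harmonic may depend on `t`),
   every slice is axisymmetric about an axis through `x₀`, and (window preconnected) ONE skew generator serves all times — the conclusion of
   `UnthreadedRigidity` for this data class, with NO bridge hypothesis left (bridge W concerns isotypic MIXING, absent for one harmonic).
§2 ★ `isotypicWindowRigidityL_one_harmonic : ∀ l ≥ 1, VirialHorn.IsotypicWindowRigidityL l 1` and ★ `separableWindowRigidity_holds :
   ProfileHorn.SeparableWindowRigidity` (g10-2's window rung at `l = 2`, horn-admissible profiles, fixed form `Q`) BY NAME.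
§4 ★ `virialSilence_at_sepShellL_slice` / `sliceAxisym_at_sepShellL_slice`: bridge V-W SLICE-LOCALLY — in an unthreaded window ALL of whose
   slices are `L⁴` (e.g. windows of sums of admissible shells), at any ONE time at which the slice happens to be an admissible separable shell
   that slice is axisymmetric (the other slices need not be separable) — the form the MIXED-PAIR / two-shell window compositions consume
   (their S-QW `QuadShellWindowAxisym` is this statement on pair windows).
§3 ★ `orderTwoVirialIdentity_of_analytic` (bridge V for profiles real-analytic on `(0,∞)`: the genericity hypothesis of the slice law is then
   free — `K` has isolated zeros or vanishes identically, and in the latter case the virial moment is `0`) and ★ `separableOrderTwoRigidityL_of_analytic`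
   (the SLICE rung `SeparableOrderTwoRigidityL` for analytic profiles, unconditionally: V ∧ S-V ∧ S-C ∧ S-Z).

HONEST LABEL: rungs about SPECIAL (separable) data — restrictions of 27585, not 27585; the residual R1 (non-analytic plateau profiles at the SLICE
level) is untouched; `UnthreadedRigidity`, W2 and NS regularity remain OPEN; MODEL/rung work — nothing here is a statement about Navier–Stokes
regularity.  0 kit.
-/

noncomputable section

-- the summit and its single sub-problem share the name (CONVENTIONS §1), as in every Theorems file
set_option linter.dupNamespace false

namespace Summit.NavierStokesRegularity.NavierStokesRegularity.Theorems.UnthreadedRigidity.ThreadingJets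

open Set Function Filter Topology MeasureTheory
open scoped RealInnerProductSpace InnerProductSpace ContDiff Laplacian
open Literature.Analysis.FluidPDE
open Summit.NavierStokesRegularity.NavierStokesRegularity.Theorems.UnthreadedRigidity.ProfileHorn
  (E3 threadingFlux IsSliceAxisymmetric IsQuadForm quadY HornAdmissible sepShell SeparableWindowRigidity)
open Summit.NavierStokesRegularity.NavierStokesRegularity.Theorems.UnthreadedRigidity.VirialHorn
  (IsSolidHarmonic IsZonal VirialAdmissible sepShellL virialMoment angForm vortAmpL isoShellL IsoAdmissibleL OrderTwoVirialIdentity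
    VirialWindowSilence IsotypicWindowRigidityL SeparableOrderTwoRigidityL
    orderTwoLawSlice_holds memLp_four_sepShellL virialNondegeneracy_holds angularLemma_holds zonalShellAxisym_holds windowAxisUniform_holds
    isSolidHarmonic_quadY virialAdmissible_two_of_hornAdmissible sepShell_eq_sepShellL)

/-! ### 0. Small tools -/

/-- the generic order-two slice law, composed from its two landed halves (a private abbreviation; the tree's `orderTwoSliceLawGeneric_holds`
lives in a module inside the theses cone). -/
private theorem sliceLawGeneric : OrderTwoSliceLawGeneric :=
  orderTwoSliceLawGeneric_of_split orderTwoLawSlice_holds virialLemmaSlice_holds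

/-- bridge V-W, composed route-independently (the tree's `virialWindowSilence_holds` by the same two ingredients). -/
private theorem windowSilence : VirialWindowSilence :=
  virialWindowSilence_of_genericSliceLaw sliceLawGeneric memLp_four_sepShellL

/-- the null profile gives the zero shell (private copy of the VIRIAL HORN one-liner). -/
private theorem sepShellL_eq_zero_of_null (H : ℝ → ℝ) (Y : E3 → ℝ) (x₀ : E3) (hH : ∀ r : ℝ, 0 ≤ r → H r = 0) (x : E3) :
    sepShellL H Y x₀ x = 0 := by
  have h0 : (fun x : E3 => (H ‖x - x₀‖ * Y (x - x₀)) • (x - x₀)) = fun _ => (0 : E3) := by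
    funext x'
    rw [hH ‖x' - x₀‖ (norm_nonneg _), zero_mul, zero_smul]
  have hc : curl (fun _ : E3 => (0 : E3)) = fun _ => (0 : E3) := by
    funext z
    ext i
    fin_cases i <;> simp [curl]
  show curl (curl (fun x : E3 => (H ‖x - x₀‖ * Y (x - x₀)) • (x - x₀))) x = 0
  rw [h0, hc, hc]

/-- the zero field is an axisymmetric slice about every point (generator: the rotation generator about `e₂`). -/
private theorem isSliceAxisymmetric_of_forall_eq_zero {v : E3 → E3} (hv : ∀ x, v x = 0) (x₀ : E3) : IsSliceAxisymmetric v x₀ := by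
  have h0 : v = fun _ => (0 : E3) := funext hv
  subst h0
  refine ⟨rotGenL, fun x => ?_, ?_, fun x => by simp [-rotGenL_apply, map_zero]⟩
  · rw [rotGenL_apply]
    exact ProfileHorn.inner_rotGen_self_zero x
  · intro h
    have h1 := congrArg (fun A : E3 →L[ℝ] E3 => (A (EuclideanSpace.single (0 : Fin 3) (1 : ℝ))) 1) h
    simp [rotGenL_apply] at h1

/-- V ∧ S-V ∧ S-C ∧ S-Z at ONE slice: `(∫ r^{2l-3}α²)·𝒜(Y) ≡ 0` for an admissible separable shell makes it an axisymmetric slice. -/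
theorem isSliceAxisymmetric_sepShellL_of_virial {l : ℕ} (hl : 1 ≤ l) {H : ℝ → ℝ} {Y : E3 → ℝ} (hH : VirialAdmissible l H)
    (hY : IsSolidHarmonic l Y) (hV : ∀ ξ : E3, virialMoment l H * angForm Y ξ = 0) (x₀ : E3) :
    IsSliceAxisymmetric (sepShellL H Y x₀) x₀ := by
  by_cases hm : virialMoment l H = 0
  · exact isSliceAxisymmetric_of_forall_eq_zero (sepShellL_eq_zero_of_null H Y x₀ (virialNondegeneracy_holds l H hl hH hm)) x₀
  · have hA : ∀ ξ : E3, angForm Y ξ = 0 := fun ξ => (mul_eq_zero.mp (hV ξ)).resolve_left hm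
    exact zonalShellAxisym_holds l H Y x₀ hY (angularLemma_holds l Y hY hA) hH

/-! ### 1. ★★ The separable window rung in every degree, unconditionally -/

section Window

variable {S : Set ℝ} {u : ℝ → E3 → E3} {x₀ : E3}

/-- ★★ **SEPARABLE WINDOWS ARE SLICEWISE AXISYMMETRIC, EVERY DEGREE, UNCONDITIONALLY**: in an unthreaded window (hypotheses of 27585 verbatim,
preconnectedness not needed) every slice of which is a virial-admissible separable shell of degree `l ≥ 1` about `x₀` — profile AND harmonic may
depend on time — every slice is axisymmetric about an axis through `x₀`.  (V-W gives `(∫ r^{2l-3}α_t²)·𝒜(Y_t) ≡ 0` at every time; S-V, S-C, S-Z.) -/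
theorem separableWindow_sliceAxisym {l : ℕ} (hl : 1 ≤ l) (hS : IsOpen S)
    (hcont : ContinuousOn (Function.uncurry u) (S ×ˢ Set.univ))
    (hdiv : ∀ t ∈ S, VectorCalculus.IsDivFree (u t))
    (hmild : ∀ s ∈ S, ∀ t ∈ S, s < t → ∀ x, u t x =
        Literature.Analysis.UnboundedOperators.heatExtension (u s) (t - s) x - oseenDuhamel 1 s u u t x)
    (hbdd : ∀ τ ∈ S, ∃ B : ℝ, ∀ t ∈ S, t ≤ τ → ∀ x, ‖u t x‖ ≤ B)
    (hunth : ∀ t ∈ S, ∀ x, inner ℝ (curl (u t) x) (x - x₀) = 0)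
    (hsep : ∀ t ∈ S, ∃ (H : ℝ → ℝ) (Y : E3 → ℝ), VirialAdmissible l H ∧ IsSolidHarmonic l Y ∧ u t = sepShellL H Y x₀) :
    ∀ t ∈ S, IsSliceAxisymmetric (u t) x₀ := by
  choose! Hf Yf hH hY hu using hsep
  have hsep' : ∀ t ∈ S, VirialAdmissible l (Hf t) ∧ IsSolidHarmonic l (Yf t) ∧ u t = sepShellL (Hf t) (Yf t) x₀ :=
    fun t ht => ⟨hH t ht, hY t ht, hu t ht⟩
  intro t ht
  have hV := windowSilence l S hl hS u x₀ hcont hdiv hmild hbdd hunth Hf Yf hsep' t ht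
  rw [hu t ht]
  exact isSliceAxisymmetric_sepShellL_of_virial hl (hH t ht) (hY t ht) hV x₀

/-- ★★ **SEPARABLE WINDOW RIGIDITY IN EVERY DEGREE, UNCONDITIONALLY**: the conclusion of `UnthreadedRigidity` (27585) — ONE skew generator `A ≠ 0`
with `D(u_t)(x)[A(x − x₀)] = A u_t(x)` for all `t ∈ S` — for unthreaded windows every slice of which is a virial-admissible separable shell of degree
`l ≥ 1` about `x₀` (time-dependent profile and harmonic).  Slicewise axisymmetry (`separableWindow_sliceAxisym`) + S-U `windowAxisUniform_holds`. -/
theorem separableWindowRigidityL {l : ℕ} (hl : 1 ≤ l) (hS : IsOpen S) (hconn : IsPreconnected S)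
    (hcont : ContinuousOn (Function.uncurry u) (S ×ˢ Set.univ))
    (hdiv : ∀ t ∈ S, VectorCalculus.IsDivFree (u t))
    (hmild : ∀ s ∈ S, ∀ t ∈ S, s < t → ∀ x, u t x =
        Literature.Analysis.UnboundedOperators.heatExtension (u s) (t - s) x - oseenDuhamel 1 s u u t x)
    (hbdd : ∀ τ ∈ S, ∃ B : ℝ, ∀ t ∈ S, t ≤ τ → ∀ x, ‖u t x‖ ≤ B)
    (hunth : ∀ t ∈ S, ∀ x, inner ℝ (curl (u t) x) (x - x₀) = 0)
    (hsep : ∀ t ∈ S, ∃ (H : ℝ → ℝ) (Y : E3 → ℝ), VirialAdmissible l H ∧ IsSolidHarmonic l Y ∧ u t = sepShellL H Y x₀) :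
    ∃ A : E3 →L[ℝ] E3, (∀ x, inner ℝ (A x) x = 0) ∧ A ≠ 0 ∧ ∀ t ∈ S, ∀ x, fderiv ℝ (u t) x (A (x - x₀)) - A (u t x) = 0 :=
  windowAxisUniform_holds S hS hconn u x₀ hcont hdiv hmild hbdd (separableWindow_sliceAxisym hl hS hcont hdiv hmild hbdd hunth hsep)

end Window

/-! ### 2. By name: `IsotypicWindowRigidityL l 1` and g10-2's `SeparableWindowRigidity` -/

/-- a one-harmonic isotypic datum is a separable shell. -/
theorem isoShellL_one (c : Fin 1 → ℝ → ℝ) (B : Fin 1 → E3 → ℝ) (x₀ : E3) : isoShellL 1 c B x₀ = sepShellL (c 0) (B 0) x₀ := by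
  unfold isoShellL sepShellL
  simp only [Fin.sum_univ_one]

/-- ★ **`IsotypicWindowRigidityL l 1` UNCONDITIONALLY, every degree `l ≥ 1`**: isotypic windows over ONE solid harmonic are separable windows. -/
theorem isotypicWindowRigidityL_one_harmonic (l : ℕ) (hl : 1 ≤ l) : IsotypicWindowRigidityL l 1 := by
  intro S hS hconn u x₀ hcont hdiv hmild hbdd hunth hiso
  obtain ⟨B, cf, _hB, hslice⟩ := hiso
  refine separableWindowRigidityL hl hS hconn hcont hdiv hmild hbdd hunth fun t ht => ?_
  obtain ⟨⟨hBm, hcm⟩, hu⟩ := hslice t ht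
  exact ⟨cf t 0, B 0, hcm 0, hBm 0, by rw [hu, isoShellL_one]⟩

/-- ★ **g10-2's WINDOW RUNG `SeparableWindowRigidity` BY NAME, UNCONDITIONALLY** (LINE g10-2 «PROFILE HORN», ns-idea-6 g10; was conditional on
bridge PH-W `HornWindowSilence`): separable `l = 2` windows over a fixed form `Q` with horn-admissible profiles — `sepShell H Q x₀ = sepShellL H Y_Q x₀`,
horn-admissible ⇒ virial-admissible at `l = 2`, `Y_Q` a degree-two solid harmonic. -/
theorem separableWindowRigidity_holds : SeparableWindowRigidity := by
  intro S hS hconn u x₀ hcont hdiv hmild hbdd hunth Q hQ hslice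
  refine separableWindowRigidityL (l := 2) (by norm_num) hS hconn hcont hdiv hmild hbdd hunth fun t ht => ?_
  obtain ⟨H, hH, hu⟩ := hslice t ht
  exact ⟨H, quadY Q, virialAdmissible_two_of_hornAdmissible hH, isSolidHarmonic_quadY hQ, by rw [hu, sepShell_eq_sepShellL]⟩

/-! ### 3. The slice level for analytic profiles: bridge V and the slice rung -/

section Slice

variable {u : ℝ → E3 → E3} {p : ℝ → E3 → ℝ} {t₀ T : ℝ}

/-- ★ **BRIDGE V FOR ANALYTIC PROFILES** (`OrderTwoVirialIdentity` with `H` real-analytic on `(0,∞)`, unconditionally): the vorticity amplitude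
`K = vortAmpL l H` of an analytic profile vanishes on no sub-interval or identically (`vortAmpL_generic_or_zero`); in the first case the GENERIC slice
law applies through the jet dictionary at `t₀` (as in `orderTwoVirialIdentity_of_sliceLaw`), in the second the virial moment is `0`. -/
theorem orderTwoVirialIdentity_of_analytic (l : ℕ) (x₀ : E3) (Y : E3 → ℝ) (H : ℝ → ℝ) (hl : 1 ≤ l) (hT : t₀ < T)
    (h : IsClassicalNSSolutionOn (Ico t₀ T) 1 0 u p) (hp : ∀ t ∈ Ico t₀ T, Tendsto (p t) (cocompact E3) (𝓝 0))
    (hY : IsSolidHarmonic l Y) (hH : VirialAdmissible l H) (hHa : AnalyticOnNhd ℝ H (Ioi 0)) (hu0 : u t₀ = sepShellL H Y x₀)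
    (hjet : ∀ x : E3, iteratedDerivWithin 2 (fun t => threadingFlux u x₀ t x) (Ici t₀) t₀ = 0) :
    ∀ ξ : E3, virialMoment l H * angForm Y ξ = 0 := by
  intro ξ
  rcases vortAmpL_generic_or_zero (l := l) hHa with hgen | hzero
  swap
  · rw [virialMoment_eq_zero_of_vortAmpL_eq_zero hH hzero, zero_mul]
  have ht₀ : t₀ ∈ Ico t₀ T := ⟨le_rfl, hT⟩
  have hsm : ContDiff ℝ ∞ (sepShellL H Y x₀) := by rw [← hu0]; exact h.contDiff_velocity ht₀
  have hdiv : VectorCalculus.IsDivFree (sepShellL H Y x₀) := by rw [← hu0]; exact h.divFree t₀ ht₀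
  have hps : ContDiff ℝ ∞ (p t₀) := h.contDiff_pressure ht₀
  have hpoi : ∀ x : E3, (Δ (p t₀)) x = -VectorCalculus.divergence (convect (sepShellL H Y x₀) (sepShellL H Y x₀)) x := by
    intro x
    rw [← hu0]
    exact laplacian_pressure_eq_Ico h hT ht₀ x
  have hj : ∀ x : E3, fluxJetTwo (sepShellL H Y x₀) (p t₀) x₀ x = 0 := by
    intro x
    rw [← hu0, ← iteratedDerivWithin_two_threadingFlux_Ici_eq_fluxJetTwo h hT]
    exact hjet x
  exact sliceLawGeneric l x₀ Y H (p t₀) hl hY hH hgen hsm hdiv hps hpoi (hp t₀ ht₀) hj ξ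

/-- ★ **THE SLICE RUNG IN EVERY DEGREE FOR ANALYTIC PROFILES, UNCONDITIONALLY** (`SeparableOrderTwoRigidityL` with `H` real-analytic on
`(0,∞)`): a virial-admissible separable shell of degree `l ≥ 1` with analytic profile, left-end slice of a classical solution on `[t₀,T)` with
decaying pressure, whose one-sided second threading jet at `t₀` vanishes, is an axisymmetric slice about `x₀`. -/
theorem separableOrderTwoRigidityL_of_analytic (l : ℕ) (x₀ : E3) (Y : E3 → ℝ) (H : ℝ → ℝ) (hl : 1 ≤ l) (hT : t₀ < T)
    (h : IsClassicalNSSolutionOn (Ico t₀ T) 1 0 u p) (hp : ∀ t ∈ Ico t₀ T, Tendsto (p t) (cocompact E3) (𝓝 0))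
    (hY : IsSolidHarmonic l Y) (hH : VirialAdmissible l H) (hHa : AnalyticOnNhd ℝ H (Ioi 0)) (hu0 : u t₀ = sepShellL H Y x₀)
    (hjet : ∀ x : E3, iteratedDerivWithin 2 (fun t => threadingFlux u x₀ t x) (Ici t₀) t₀ = 0) :
    IsSliceAxisymmetric (u t₀) x₀ := by
  rw [hu0]
  exact isSliceAxisymmetric_sepShellL_of_virial hl hH hY
    (orderTwoVirialIdentity_of_analytic l x₀ Y H hl hT h hp hY hH hHa hu0 hjet) x₀

/-- the slice rung re-based: `OrderTwoVirialIdentity → SeparableOrderTwoRigidityL` with S-V, S-C, S-Z discharged (route-independent twin of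
`separableOrderTwoRigidityL_of_virial _ virialNondegeneracy_holds angularLemma_holds zonalShellAxisym_holds`). -/
theorem separableOrderTwoRigidityL_of_virialIdentity (hV : OrderTwoVirialIdentity) : SeparableOrderTwoRigidityL := by
  intro l t₀ T u p x₀ Y H hl hT hsol hp hY hH hu hj2
  rw [hu]
  exact isSliceAxisymmetric_sepShellL_of_virial hl hH hY (hV l t₀ T u p x₀ Y H hl hT hsol hp hY hH hu hj2) x₀

end Slice

/-! ### 4. Bridge V-W slice-locally (windows with `L⁴` slices) -/

section Local

variable {S : Set ℝ} {u : ℝ → E3 → E3} {x₀ : E3}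

/-- ★ **V-W SLICE-LOCALLY**: in an unthreaded window (hypotheses of 27585 verbatim, preconnectedness not needed) all of whose slices are `L⁴`,
at any time `t ∈ S` at which the slice is a virial-admissible separable shell `curl curl (H(|y|)Y(y) y)` of degree `l ≥ 1` about `x₀`:
`(∫ r^{2l-3}α²)·𝒜(Y) ≡ 0`.  (The body of `virialWindowSilence_of_genericSliceLaw` at one time: the slice is analytic, so `H` is analytic off the
origin when `Y ≢ 0`, `K` is generic or `≡ 0`; the window pressure gauge needs only the `L⁴` size of the slices.) -/
theorem virialSilence_at_sepShellL_slice {l : ℕ} (hl : 1 ≤ l) (hS : IsOpen S)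
    (hcont : ContinuousOn (Function.uncurry u) (S ×ˢ Set.univ))
    (hdiv : ∀ t ∈ S, VectorCalculus.IsDivFree (u t))
    (hmild : ∀ s ∈ S, ∀ t ∈ S, s < t → ∀ x, u t x =
        Literature.Analysis.UnboundedOperators.heatExtension (u s) (t - s) x - oseenDuhamel 1 s u u t x)
    (hbdd : ∀ τ ∈ S, ∃ B : ℝ, ∀ t ∈ S, t ≤ τ → ∀ x, ‖u t x‖ ≤ B)
    (hunth : ∀ t ∈ S, ∀ x, inner ℝ (curl (u t) x) (x - x₀) = 0)
    (h4 : ∀ τ ∈ S, MemLp (u τ) 4 volume) {t : ℝ} (ht : t ∈ S) {H : ℝ → ℝ} {Y : E3 → ℝ}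
    (hH : VirialAdmissible l H) (hY : IsSolidHarmonic l Y) (hu : u t = sepShellL H Y x₀) :
    ∀ ξ : E3, virialMoment l H * angForm Y ξ = 0 := by
  intro ξ
  -- the degenerate harmonic
  by_cases hYne : ∃ y : E3, Y y ≠ 0
  swap
  · push Not at hYne
    rw [angForm_eq_zero_of_forall_eq_zero hYne, mul_zero]
  -- the profile is analytic: generic, or without vorticity
  have han : AnalyticOnNhd ℝ (sepShellL H Y x₀) univ := by
    rw [← hu]; exact VirialHorn.window_analyticOnNhd_slice hS hcont hmild hbdd ht
  rcases vortAmpL_generic_or_zero (l := l) (analyticOnNhd_profile hl hY hH x₀ han hYne) with hgen | hzero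
  swap
  · rw [virialMoment_eq_zero_of_vortAmpL_eq_zero hH hzero, zero_mul]
  -- generic: the pressure gauge and the open-window dictionary
  obtain ⟨s, T₂, hst, htT, _hJS, p, hcl, hdec⟩ := exists_classical_decaying_pressure hS hcont hdiv hmild hbdd h4 ht
  have htJ : t ∈ Ioo s T₂ := ⟨hst, htT⟩
  have hjet : ∀ x : E3, fluxJetTwo (sepShellL H Y x₀) (p t) x₀ x = 0 := fun x => by
    rw [← hu, ← iteratedDeriv_two_threadingFlux_eq_fluxJetTwo hcl isOpen_Ioo htJ]
    exact iteratedDeriv_two_threadingFlux_eq_zero_of_unthreaded hS hunth ht x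
  have hsm : ContDiff ℝ ∞ (sepShellL H Y x₀) := by rw [← hu]; exact hcl.contDiff_velocity htJ
  have hdv : VectorCalculus.IsDivFree (sepShellL H Y x₀) := by rw [← hu]; exact hdiv t ht
  have hps : ContDiff ℝ ∞ (p t) := hcl.contDiff_pressure htJ
  have hcl' : Ioo s T₂ ⊆ closure (interior (Ioo s T₂)) := by
    rw [isOpen_Ioo.interior_eq]; exact subset_closure
  have hpoi : ∀ x : E3, (Δ (p t)) x = -VectorCalculus.divergence (convect (sepShellL H Y x₀) (sepShellL H Y x₀)) x := fun x => by
    rw [← hu]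
    exact laplacian_pressure_eq hcl isOpen_Ioo.uniqueDiffOn hcl' htJ x
  exact sliceLawGeneric l x₀ Y H (p t) hl hY hH hgen hsm hdv hps hpoi hdec hjet ξ

/-- ★ **SLICE-LOCAL WINDOW AXISYMMETRY**: in an unthreaded window with `L⁴` slices, a slice which is an admissible separable shell of degree
`l ≥ 1` about `x₀` is axisymmetric about an axis through `x₀` — whatever the other slices are. -/
theorem sliceAxisym_at_sepShellL_slice {l : ℕ} (hl : 1 ≤ l) (hS : IsOpen S)
    (hcont : ContinuousOn (Function.uncurry u) (S ×ˢ Set.univ))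
    (hdiv : ∀ t ∈ S, VectorCalculus.IsDivFree (u t))
    (hmild : ∀ s ∈ S, ∀ t ∈ S, s < t → ∀ x, u t x =
        Literature.Analysis.UnboundedOperators.heatExtension (u s) (t - s) x - oseenDuhamel 1 s u u t x)
    (hbdd : ∀ τ ∈ S, ∃ B : ℝ, ∀ t ∈ S, t ≤ τ → ∀ x, ‖u t x‖ ≤ B)
    (hunth : ∀ t ∈ S, ∀ x, inner ℝ (curl (u t) x) (x - x₀) = 0)
    (h4 : ∀ τ ∈ S, MemLp (u τ) 4 volume) {t : ℝ} (ht : t ∈ S) {H : ℝ → ℝ} {Y : E3 → ℝ}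
    (hH : VirialAdmissible l H) (hY : IsSolidHarmonic l Y) (hu : u t = sepShellL H Y x₀) :
    IsSliceAxisymmetric (u t) x₀ := by
  rw [hu]
  exact isSliceAxisymmetric_sepShellL_of_virial hl hH hY
    (virialSilence_at_sepShellL_slice hl hS hcont hdiv hmild hbdd hunth h4 ht hH hY hu) x₀

end Local

end Summit.NavierStokesRegularity.NavierStokesRegularity.Theorems.UnthreadedRigidity.ThreadingJets

end
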